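import Mathlib
import HarnessLib
import Summits.NavierStokesRegularity.NavierStokesRegularity.Theorems.PoloidalWindowDoorPoloidalWindowRigidityConstantShearMeans

/-!
# Route `PoloidalWindowDoor`, crux `PoloidalWindowRigidity` (K2, stmt-NavierStokesRegularity-19708) —
# the CONSTANT-SHEAR («wave») stratum: averaged energy identity, flux bound and the KEY inequality

Cell ns-regularity-ideate, seat ns-poloidal-K2-p2 (stub-worker, gen 2; support lemmas `--supports` the crux,
`--as helper`).  Continuation of `…ConstantShearMeans` (same one-slice setting: `u ∈ C²` divergence-free, `θ = u₂`,
`|u| ≤ M₀`, `‖Du‖ ≤ M₁`, vertical momentum equation `θₜ + Dθ(u) − Σᵢ∂ᵢ∂ᵢθ = g(x₂)` with `g` a function of the height):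

* `energy_mean` — (c) under the WAVE IDENTITY `∂₂²θ = −μ(∂₀²θ + ∂₁²θ)` (the slice form of constant proportional
  shear `∂₂u_h = μ∇_hθ` plus `div u = 0`):
  `⟨2θθₜ⟩ + ⟨∂₂θ³⟩ + 2(1−μ)⟨|∇_hθ|²⟩ − 2g⟨θ⟩ = O((M₀³ + 2|1−μ|M₀M₁)K/R)` — the pressure work FACTORS through `⟨θ⟩`;
* `abs_flux_le` — `|½⟨θ³⟩ − ⟨θ⟩⟨θ²⟩ + ½⟨θ⟩³| ≤ (3/2)M₀(⟨θ²⟩ − ⟨θ⟩²)` (third centred moment ≤ sup × variance);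
* `key_mean` — (b) of `…ConstantShearMeans` inserted in (c): with `V = ⟨θ²⟩ − ⟨θ⟩²` and
  `G = ½⟨θ³⟩ − ⟨θ⟩⟨θ²⟩ + ½⟨θ⟩³`, the VALUES of `∂ₜV` and `∂_zG` obey
  `V̇ + 2G_z + 2(1−μ)⟨|∇_hθ|²⟩ ≤ (8M₀³ + (4 + 2|1−μ|)M₀M₁)K/R` — a one-dimensional conservation law in the height with
  a non-positive source when `μ < 1`, up to `O(1/R)`.

WHAT THIS IS NOT: not a claim about Navier–Stokes — averaged calculus identities for one located stratum of a door
route's Type-I Liouville problem (bears_on LADDER-NS N0, rung N0-LocalTubeDoorPoloidal).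
-/

noncomputable section

-- the summit and its single sub-problem share the name (CONVENTIONS §1), as in every Theorems file
set_option linter.dupNamespace false

namespace Summit.NavierStokesRegularity.NavierStokesRegularity.Theorems.PoloidalWindowDoorPoloidalWindowRigidityConstantShearEnergy

open MeasureTheory Set Function Filter Topology Metric
open scoped RealInnerProductSpace InnerProductSpace ContDiff
open Summit.NavierStokesRegularity.NavierStokesRegularity.Theorems.PoloidalWindowDoorPoloidalWindowRigidityHorizontalMean
open Summit.NavierStokesRegularity.NavierStokesRegularity.Theorems.PoloidalWindowDoorPoloidalWindowRigidityConstantShearMeans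

section Slice

variable (φ : ContDiffBump (0 : EuclideanSpace ℝ (Fin 2))) (c : EuclideanSpace ℝ (Fin 3)) {R : ℝ} (z : ℝ)
  {u : EuclideanSpace ℝ (Fin 3) → EuclideanSpace ℝ (Fin 3)} {M₀ M₁ : ℝ}
  {θt : EuclideanSpace ℝ (Fin 3) → ℝ} {g : ℝ → ℝ} {μ : ℝ}

/-! ### (c) the horizontally averaged energy identity for `θ²` under the wave identity -/

/-- **(c) `⟨2θθₜ⟩ + ⟨∂₂θ³⟩ + 2(1−μ)⟨|∇_hθ|²⟩ − 2g⟨θ⟩ = O((M₀³ + 2|1−μ|M₀M₁)K/R)`.**  Multiply the vertical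
momentum equation by `2θ`: `2θ Dθ(u) = ∂₀(u₀θ²) + ∂₁(u₁θ²) + ∂₂(θ³)` (by `div u = 0`) and, by the WAVE IDENTITY
`∂₂²θ = −μ(∂₀²θ + ∂₁²θ)`, `2θ Σᵢ∂ᵢ∂ᵢθ = 2(1−μ)θΔ_hθ = 2(1−μ)[∂₀(θ∂₀θ) + ∂₁(θ∂₁θ) − |∇_hθ|²]`; the pressure work
`2gθ` averages to `2g⟨θ⟩` because `g` depends on the height only. -/
theorem energy_mean (hu : ContDiff ℝ 2 u)
    (hdiv : ∀ x, fderiv ℝ u x (EuclideanSpace.single 0 (1 : ℝ)) 0 + fderiv ℝ u x (EuclideanSpace.single 1 (1 : ℝ)) 1 +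
      fderiv ℝ u x (EuclideanSpace.single 2 (1 : ℝ)) 2 = 0)
    (hM₀ : ∀ x, ‖u x‖ ≤ M₀) (hM₁ : ∀ x, ‖fderiv ℝ u x‖ ≤ M₁) (hθt : Continuous θt)
    (heq : ∀ x, θt x + fderiv ℝ (fun y => u y 2) x (u x) -
      ∑ i : Fin 3, fderiv ℝ (fun y => fderiv ℝ (fun y' => u y' 2) y (EuclideanSpace.single i (1 : ℝ))) x
        (EuclideanSpace.single i (1 : ℝ)) = g (x 2))
    (hwave : ∀ x, fderiv ℝ (fun y => fderiv ℝ (fun y' => u y' 2) y (EuclideanSpace.single 2 (1 : ℝ))) x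
        (EuclideanSpace.single 2 (1 : ℝ)) =
      -μ * (fderiv ℝ (fun y => fderiv ℝ (fun y' => u y' 2) y (EuclideanSpace.single 0 (1 : ℝ))) x
          (EuclideanSpace.single 0 (1 : ℝ)) +
        fderiv ℝ (fun y => fderiv ℝ (fun y' => u y' 2) y (EuclideanSpace.single 1 (1 : ℝ))) x
          (EuclideanSpace.single 1 (1 : ℝ))))
    (hR : 0 < R) :
    |hmean φ c R z (fun x => 2 * u x 2 * θt x) +
        hmean φ c R z (fun x => fderiv ℝ (fun y => u y 2 ^ 3) x (EuclideanSpace.single 2 (1 : ℝ))) +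
        2 * (1 - μ) * hmean φ c R z (fun x => fderiv ℝ (fun y => u y 2) x (EuclideanSpace.single 0 (1 : ℝ)) ^ 2 +
          fderiv ℝ (fun y => u y 2) x (EuclideanSpace.single 1 (1 : ℝ)) ^ 2) -
        2 * g (c 2 + z) * hmean φ c R z (fun x => u x 2)| ≤
      R⁻¹ * (M₀ * M₀ * M₀ + 2 * |1 - μ| * (M₀ * M₁)) * bumpK φ := by
  have hud : Differentiable ℝ u := hu.differentiable (by norm_num)
  have hθ2 : ContDiff ℝ 2 (fun y => u y 2) := contDiff_two_vert hu
  have hθd : Differentiable ℝ (fun y => u y 2) := hθ2.differentiable (by norm_num)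
  have hc0 : ContDiff ℝ 1 (fun y => u y 0) := contDiff_coord (hu.of_le (by norm_num)) 0
  have hc1 : ContDiff ℝ 1 (fun y => u y 1) := contDiff_coord (hu.of_le (by norm_num)) 1
  have hM₀0 : 0 ≤ M₀ := (norm_nonneg _).trans (hM₀ 0)
  -- named pieces
  obtain ⟨Φ₀, hΦ₀⟩ : ∃ Φ₀ : EuclideanSpace ℝ (Fin 3) → ℝ, Φ₀ = fun y => u y 0 * u y 2 ^ 2 := ⟨_, rfl⟩
  obtain ⟨Φ₁, hΦ₁⟩ : ∃ Φ₁ : EuclideanSpace ℝ (Fin 3) → ℝ, Φ₁ = fun y => u y 1 * u y 2 ^ 2 := ⟨_, rfl⟩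
  obtain ⟨Ψ₀, hΨ₀⟩ : ∃ Ψ₀ : EuclideanSpace ℝ (Fin 3) → ℝ,
      Ψ₀ = fun y => fderiv ℝ (fun y' => u y' 2) y (EuclideanSpace.single 0 (1 : ℝ)) := ⟨_, rfl⟩
  obtain ⟨Ψ₁, hΨ₁⟩ : ∃ Ψ₁ : EuclideanSpace ℝ (Fin 3) → ℝ,
      Ψ₁ = fun y => fderiv ℝ (fun y' => u y' 2) y (EuclideanSpace.single 1 (1 : ℝ)) := ⟨_, rfl⟩
  obtain ⟨Ω₀, hΩ₀⟩ : ∃ Ω₀ : EuclideanSpace ℝ (Fin 3) → ℝ, Ω₀ = fun y => u y 2 * Ψ₀ y := ⟨_, rfl⟩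
  obtain ⟨Ω₁, hΩ₁⟩ : ∃ Ω₁ : EuclideanSpace ℝ (Fin 3) → ℝ, Ω₁ = fun y => u y 2 * Ψ₁ y := ⟨_, rfl⟩
  obtain ⟨A, hA⟩ : ∃ A : EuclideanSpace ℝ (Fin 3) → ℝ, A = fun x =>
      fderiv ℝ Φ₀ x (EuclideanSpace.single 0 (1 : ℝ)) + fderiv ℝ Φ₁ x (EuclideanSpace.single 1 (1 : ℝ)) := ⟨_, rfl⟩
  obtain ⟨B, hB⟩ : ∃ B : EuclideanSpace ℝ (Fin 3) → ℝ, B = fun x =>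
      fderiv ℝ (fun y => u y 2 ^ 3) x (EuclideanSpace.single 2 (1 : ℝ)) := ⟨_, rfl⟩
  obtain ⟨Cc, hCc⟩ : ∃ Cc : EuclideanSpace ℝ (Fin 3) → ℝ, Cc = fun x =>
      fderiv ℝ Ω₀ x (EuclideanSpace.single 0 (1 : ℝ)) + fderiv ℝ Ω₁ x (EuclideanSpace.single 1 (1 : ℝ)) := ⟨_, rfl⟩
  obtain ⟨Q, hQ⟩ : ∃ Q : EuclideanSpace ℝ (Fin 3) → ℝ, Q = fun x =>
      fderiv ℝ (fun y => u y 2) x (EuclideanSpace.single 0 (1 : ℝ)) ^ 2 +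
        fderiv ℝ (fun y => u y 2) x (EuclideanSpace.single 1 (1 : ℝ)) ^ 2 := ⟨_, rfl⟩
  obtain ⟨P, hP⟩ : ∃ P : EuclideanSpace ℝ (Fin 3) → ℝ, P = fun x => 2 * u x 2 * θt x := ⟨_, rfl⟩
  have hΨ₀c : ContDiff ℝ 1 Ψ₀ := by rw [hΨ₀]; exact contDiff_one_fderiv_vert hu _
  have hΨ₁c : ContDiff ℝ 1 Ψ₁ := by rw [hΨ₁]; exact contDiff_one_fderiv_vert hu _
  have hΦ₀c : ContDiff ℝ 1 Φ₀ := by rw [hΦ₀]; exact hc0.mul ((hθ2.of_le (by norm_num)).pow 2)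
  have hΦ₁c : ContDiff ℝ 1 Φ₁ := by rw [hΦ₁]; exact hc1.mul ((hθ2.of_le (by norm_num)).pow 2)
  have hΩ₀c : ContDiff ℝ 1 Ω₀ := by rw [hΩ₀]; exact (hθ2.of_le (by norm_num)).mul hΨ₀c
  have hΩ₁c : ContDiff ℝ 1 Ω₁ := by rw [hΩ₁]; exact (hθ2.of_le (by norm_num)).mul hΨ₁c
  have hΨ₀b : ∀ x, |Ψ₀ x| ≤ M₁ := fun x => by
    rw [hΨ₀]; dsimp only; rw [fderiv_coord_apply (hud x) 2]; exact abs_fderiv_single_le hM₁ x 0 2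
  have hΨ₁b : ∀ x, |Ψ₁ x| ≤ M₁ := fun x => by
    rw [hΨ₁]; dsimp only; rw [fderiv_coord_apply (hud x) 2]; exact abs_fderiv_single_le hM₁ x 1 2
  have hsqb : ∀ x, |u x 2 ^ 2| ≤ M₀ * M₀ := fun x => by
    rw [abs_pow, pow_two]; exact mul_le_mul (abs_coord_le hM₀ x 2) (abs_coord_le hM₀ x 2) (abs_nonneg _) hM₀0
  have hΦ₀b : ∀ x, |Φ₀ x| ≤ M₀ * M₀ * M₀ := fun x => by
    rw [hΦ₀]; dsimp only; rw [abs_mul]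
    calc _ ≤ M₀ * (M₀ * M₀) := mul_le_mul (abs_coord_le hM₀ x 0) (hsqb x) (abs_nonneg _) hM₀0
      _ = _ := by ring
  have hΦ₁b : ∀ x, |Φ₁ x| ≤ M₀ * M₀ * M₀ := fun x => by
    rw [hΦ₁]; dsimp only; rw [abs_mul]
    calc _ ≤ M₀ * (M₀ * M₀) := mul_le_mul (abs_coord_le hM₀ x 1) (hsqb x) (abs_nonneg _) hM₀0
      _ = _ := by ring
  have hΩ₀b : ∀ x, |Ω₀ x| ≤ M₀ * M₁ := fun x => by
    rw [hΩ₀]; dsimp only; rw [abs_mul]; exact mul_le_mul (abs_coord_le hM₀ x 2) (hΨ₀b x) (abs_nonneg _) hM₀0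
  have hΩ₁b : ∀ x, |Ω₁ x| ≤ M₀ * M₁ := fun x => by
    rw [hΩ₁]; dsimp only; rw [abs_mul]; exact mul_le_mul (abs_coord_le hM₀ x 2) (hΨ₁b x) (abs_nonneg _) hM₀0
  -- the pointwise identity `2gθ = 2θθₜ + A + B − 2(1−μ)Cc + 2(1−μ)Q`
  have hpt : ∀ x, 2 * g (x 2) * u x 2 = P x + A x + B x - 2 * (1 - μ) * Cc x + 2 * (1 - μ) * Q x := by
    intro x
    have h := heq x
    simp only [Fin.sum_univ_three] at h
    rw [fderiv_apply_eq_sum] at h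
    simp only [Fin.sum_univ_three] at h
    rw [← hΨ₀, ← hΨ₁, hwave x] at h
    rw [← hΨ₀, ← hΨ₁] at h
    have hsqd : DifferentiableAt ℝ (fun y => u y 2 ^ 2) x := (hθd x).pow 2
    have p0 : fderiv ℝ Φ₀ x (EuclideanSpace.single 0 (1 : ℝ)) =
        u x 0 * (2 * u x 2 * fderiv ℝ (fun y => u y 2) x (EuclideanSpace.single 0 (1 : ℝ))) +
          u x 2 ^ 2 * fderiv ℝ u x (EuclideanSpace.single 0 (1 : ℝ)) 0 := by
      rw [hΦ₀, fderiv_mul_apply (g₂ := fun y => u y 2 ^ 2) ((hc0.differentiable one_ne_zero) x) hsqd,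
        fderiv_sq_apply (hθd x), fderiv_coord_apply (hud x) 0]
    have p1 : fderiv ℝ Φ₁ x (EuclideanSpace.single 1 (1 : ℝ)) =
        u x 1 * (2 * u x 2 * fderiv ℝ (fun y => u y 2) x (EuclideanSpace.single 1 (1 : ℝ))) +
          u x 2 ^ 2 * fderiv ℝ u x (EuclideanSpace.single 1 (1 : ℝ)) 1 := by
      rw [hΦ₁, fderiv_mul_apply (g₂ := fun y => u y 2 ^ 2) ((hc1.differentiable one_ne_zero) x) hsqd,
        fderiv_sq_apply (hθd x), fderiv_coord_apply (hud x) 1]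
    have p2 : B x = 3 * u x 2 ^ 2 * fderiv ℝ u x (EuclideanSpace.single 2 (1 : ℝ)) 2 := by
      rw [hB]; dsimp only; rw [fderiv_cube_apply (hθd x), fderiv_coord_apply (hud x) 2]
    have p3 : fderiv ℝ (fun y => u y 2) x (EuclideanSpace.single 2 (1 : ℝ)) =
        fderiv ℝ u x (EuclideanSpace.single 2 (1 : ℝ)) 2 := fderiv_coord_apply (hud x) 2 _
    have q0 : fderiv ℝ Ω₀ x (EuclideanSpace.single 0 (1 : ℝ)) =
        u x 2 * fderiv ℝ Ψ₀ x (EuclideanSpace.single 0 (1 : ℝ)) + Ψ₀ x * fderiv ℝ (fun y => u y 2) x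
          (EuclideanSpace.single 0 (1 : ℝ)) := by
      rw [hΩ₀, fderiv_mul_apply (hθd x) ((hΨ₀c.differentiable one_ne_zero) x)]
    have q1 : fderiv ℝ Ω₁ x (EuclideanSpace.single 1 (1 : ℝ)) =
        u x 2 * fderiv ℝ Ψ₁ x (EuclideanSpace.single 1 (1 : ℝ)) + Ψ₁ x * fderiv ℝ (fun y => u y 2) x
          (EuclideanSpace.single 1 (1 : ℝ)) := by
      rw [hΩ₁, fderiv_mul_apply (hθd x) ((hΨ₁c.differentiable one_ne_zero) x)]
    have r0 : Ψ₀ x = fderiv ℝ (fun y => u y 2) x (EuclideanSpace.single 0 (1 : ℝ)) := by rw [hΨ₀]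
    have r1 : Ψ₁ x = fderiv ℝ (fun y => u y 2) x (EuclideanSpace.single 1 (1 : ℝ)) := by rw [hΨ₁]
    have pA : A x = fderiv ℝ Φ₀ x (EuclideanSpace.single 0 (1 : ℝ)) + fderiv ℝ Φ₁ x (EuclideanSpace.single 1 (1 : ℝ)) := by
      rw [hA]
    have pC : Cc x = fderiv ℝ Ω₀ x (EuclideanSpace.single 0 (1 : ℝ)) + fderiv ℝ Ω₁ x (EuclideanSpace.single 1 (1 : ℝ)) := by
      rw [hCc]
    have pQ : Q x = fderiv ℝ (fun y => u y 2) x (EuclideanSpace.single 0 (1 : ℝ)) ^ 2 +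
        fderiv ℝ (fun y => u y 2) x (EuclideanSpace.single 1 (1 : ℝ)) ^ 2 := by rw [hQ]
    have pP : P x = 2 * u x 2 * θt x := by rw [hP]
    rw [p3] at h
    linear_combination (-(2 * u x 2)) * h - pP - pA - p0 - p1 - p2 - u x 2 ^ 2 * hdiv x +
      2 * (1 - μ) * (pC + q0 + q1 - pQ +
        fderiv ℝ (fun y => u y 2) x (EuclideanSpace.single 0 (1 : ℝ)) * r0 +
        fderiv ℝ (fun y => u y 2) x (EuclideanSpace.single 1 (1 : ℝ)) * r1)
  -- average it
  have hcP : Continuous P := by rw [hP]; exact (continuous_const.mul (contDiff_coord hu 2).continuous).mul hθt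
  have hcA : Continuous A := by
    rw [hA]
    exact ((hΦ₀c.continuous_fderiv one_ne_zero).clm_apply continuous_const).add
      ((hΦ₁c.continuous_fderiv one_ne_zero).clm_apply continuous_const)
  have hcB : Continuous B := by
    rw [hB]; exact ((hθ2.pow 3).continuous_fderiv (by norm_num)).clm_apply continuous_const
  have hcC : Continuous Cc := by
    rw [hCc]
    exact ((hΩ₀c.continuous_fderiv one_ne_zero).clm_apply continuous_const).add
      ((hΩ₁c.continuous_fderiv one_ne_zero).clm_apply continuous_const)
  have hcQ : Continuous Q := by
    rw [hQ]
    exact (((hθ2.continuous_fderiv (by norm_num)).clm_apply continuous_const).pow 2).add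
      (((hθ2.continuous_fderiv (by norm_num)).clm_apply continuous_const).pow 2)
  have hcC' : Continuous fun x => 2 * (1 - μ) * Cc x := continuous_const.mul hcC
  have hcQ' : Continuous fun x => 2 * (1 - μ) * Q x := continuous_const.mul hcQ
  have hmean_g : hmean φ c R z (fun x => P x + A x + B x - 2 * (1 - μ) * Cc x + 2 * (1 - μ) * Q x) =
      2 * g (c 2 + z) * hmean φ c R z (fun x => u x 2) := by
    rw [← hmean_const_mul]
    unfold hmean
    congr 1
    funext y
    beta_reduce
    rw [← hpt, pt_apply_two]
  rw [hmean_add φ c R z (F := fun x => P x + A x + B x - 2 * (1 - μ) * Cc x) (G := fun x => 2 * (1 - μ) * Q x)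
      (((hcP.add hcA).add hcB).sub hcC') hcQ',
    hmean_sub φ c R z (F := fun x => P x + A x + B x) (G := fun x => 2 * (1 - μ) * Cc x) ((hcP.add hcA).add hcB) hcC',
    hmean_add φ c R z (F := fun x => P x + A x) (G := B) (hcP.add hcA) hcB,
    hmean_add φ c R z (F := P) (G := A) hcP hcA, hmean_const_mul, hmean_const_mul] at hmean_g
  have eA : |hmean φ c R z A| ≤ R⁻¹ * (M₀ * M₀ * M₀) * bumpK φ := by
    rw [hA]; exact abs_hmean_hdiv_le φ c z hR hΦ₀c hΦ₁c hΦ₀b hΦ₁b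
  have eC : |hmean φ c R z Cc| ≤ R⁻¹ * (M₀ * M₁) * bumpK φ := by
    rw [hCc]; exact abs_hmean_hdiv_le φ c z hR hΩ₀c hΩ₁c hΩ₀b hΩ₁b
  rw [← hP, ← hB, ← hQ]
  have hK : 0 ≤ R⁻¹ * (M₀ * M₁) * bumpK φ := by
    have := bumpK_nonneg φ
    have hM₁0 : 0 ≤ M₁ := (norm_nonneg _).trans (hM₁ 0)
    positivity
  calc _ = |-hmean φ c R z A + 2 * (1 - μ) * hmean φ c R z Cc| := by
        congr 1; linear_combination hmean_g
    _ ≤ |hmean φ c R z A| + |2 * (1 - μ)| * |hmean φ c R z Cc| := by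
        rw [← abs_neg (hmean φ c R z A), ← abs_mul]; exact abs_add_le _ _
    _ ≤ R⁻¹ * (M₀ * M₀ * M₀) * bumpK φ + |2 * (1 - μ)| * (R⁻¹ * (M₀ * M₁) * bumpK φ) :=
        add_le_add eA (mul_le_mul_of_nonneg_left eC (abs_nonneg _))
    _ = R⁻¹ * (M₀ * M₀ * M₀ + 2 * |1 - μ| * (M₀ * M₁)) * bumpK φ := by
        rw [abs_mul, abs_two]; ring

/-! ### The flux of the horizontal variance and the KEY inequality -/

/-- **Flux bound**: with `m = ⟨θ⟩`, `E = ⟨θ²⟩`, `T = ⟨θ³⟩` and `|θ| ≤ M₀`,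
`|½T − mE + ½m³| ≤ (3/2) M₀ (E − m²)` (indeed `½T − mE + ½m³ = ½⟨(θ−m)³⟩ + ½m(E − m²)`). -/
theorem abs_flux_le (hu : ContDiff ℝ 2 u) (hM₀ : ∀ x, ‖u x‖ ≤ M₀) :
    |hmean φ c R z (fun x => u x 2 ^ 3) / 2 - hmean φ c R z (fun x => u x 2) * hmean φ c R z (fun x => u x 2 ^ 2) +
        hmean φ c R z (fun x => u x 2) ^ 3 / 2| ≤
      3 / 2 * M₀ * (hmean φ c R z (fun x => u x 2 ^ 2) - hmean φ c R z (fun x => u x 2) ^ 2) := by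
  have hθc : Continuous (fun y => u y 2) := (contDiff_coord hu 2).continuous
  have hM₀0 : 0 ≤ M₀ := (norm_nonneg _).trans (hM₀ 0)
  set m := hmean φ c R z (fun x => u x 2) with hm
  have hmb : |m| ≤ M₀ := abs_hmean_le φ c R z hθc fun x => abs_coord_le hM₀ x 2
  have hV : 0 ≤ hmean φ c R z (fun x => u x 2 ^ 2) - m ^ 2 := hmean_variance_nonneg φ c R z hθc
  -- the third centred moment
  have hexp : (fun x => (u x 2 - m) ^ 3) = fun x => u x 2 ^ 3 + ((-3 * m) * u x 2 ^ 2 + ((3 * m ^ 2) * u x 2 + (-m ^ 3))) := by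
    funext x; ring
  have hc3 : hmean φ c R z (fun x => (u x 2 - m) ^ 3) =
      hmean φ c R z (fun x => u x 2 ^ 3) - 3 * m * hmean φ c R z (fun x => u x 2 ^ 2) + 2 * m ^ 3 := by
    rw [hexp, hmean_add φ c R z (F := fun x => u x 2 ^ 3) (G := fun x => (-3 * m) * u x 2 ^ 2 + ((3 * m ^ 2) * u x 2 + (-m ^ 3)))
        (hθc.pow 3) ((continuous_const.mul (hθc.pow 2)).add ((continuous_const.mul hθc).add continuous_const)),
      hmean_add φ c R z (F := fun x => (-3 * m) * u x 2 ^ 2) (G := fun x => (3 * m ^ 2) * u x 2 + (-m ^ 3))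
        (continuous_const.mul (hθc.pow 2)) ((continuous_const.mul hθc).add continuous_const),
      hmean_add φ c R z (F := fun x => (3 * m ^ 2) * u x 2) (G := fun _ => -m ^ 3) (continuous_const.mul hθc)
        continuous_const, hmean_const_mul, hmean_const_mul, hmean_const, ← hm]
    ring
  have hc3b : |hmean φ c R z (fun x => (u x 2 - m) ^ 3)| ≤ (2 * M₀) * (hmean φ c R z (fun x => u x 2 ^ 2) - m ^ 2) := by
    refine abs_hmean_cube_centred_le φ c R z hθc fun x => ?_
    calc |u x 2 - m| ≤ |u x 2| + |m| := abs_sub _ _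
      _ ≤ M₀ + M₀ := add_le_add (abs_coord_le hM₀ x 2) hmb
      _ = 2 * M₀ := by ring
  have hid : hmean φ c R z (fun x => u x 2 ^ 3) / 2 - m * hmean φ c R z (fun x => u x 2 ^ 2) + m ^ 3 / 2 =
      hmean φ c R z (fun x => (u x 2 - m) ^ 3) / 2 + m * (hmean φ c R z (fun x => u x 2 ^ 2) - m ^ 2) / 2 := by
    rw [hc3]; ring
  rw [hid]
  calc _ ≤ |hmean φ c R z (fun x => (u x 2 - m) ^ 3) / 2| + |m * (hmean φ c R z (fun x => u x 2 ^ 2) - m ^ 2) / 2| :=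
        abs_add_le _ _
    _ ≤ (2 * M₀) * (hmean φ c R z (fun x => u x 2 ^ 2) - m ^ 2) / 2 +
          M₀ * (hmean φ c R z (fun x => u x 2 ^ 2) - m ^ 2) / 2 := by
        rw [abs_div, abs_div, abs_two, abs_mul, abs_of_nonneg hV]
        exact add_le_add (div_le_div_of_nonneg_right hc3b zero_le_two)
          (div_le_div_of_nonneg_right (mul_le_mul_of_nonneg_right hmb hV) zero_le_two)
    _ = _ := by ring

/-- **KEY inequality (one slice, averaged)**: inserting (b) into (c), the horizontal variance
`V = ⟨θ²⟩ − ⟨θ⟩²` and the flux `G = ½⟨θ³⟩ − ⟨θ⟩⟨θ²⟩ + ½⟨θ⟩³` satisfy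
`V̇ + 2G_z + 2(1−μ)⟨|∇_hθ|²⟩ ≤ (8M₀³ + (4 + 2|1−μ|)M₀M₁)K/R`, where `V̇ := ⟨2θθₜ⟩ − 2⟨θ⟩⟨θₜ⟩` and
`G_z := ½⟨∂₂θ³⟩ − ⟨∂₂θ⟩⟨θ²⟩ − ⟨θ⟩⟨∂₂θ²⟩ + (3/2)⟨θ⟩²⟨∂₂θ⟩` are the values of `∂ₜV`, `∂_zG` (the companion file
identifies them with the actual derivatives). -/
theorem key_mean (hu : ContDiff ℝ 2 u)
    (hdiv : ∀ x, fderiv ℝ u x (EuclideanSpace.single 0 (1 : ℝ)) 0 + fderiv ℝ u x (EuclideanSpace.single 1 (1 : ℝ)) 1 +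
      fderiv ℝ u x (EuclideanSpace.single 2 (1 : ℝ)) 2 = 0)
    (hM₀ : ∀ x, ‖u x‖ ≤ M₀) (hM₁ : ∀ x, ‖fderiv ℝ u x‖ ≤ M₁) (hθt : Continuous θt)
    (heq : ∀ x, θt x + fderiv ℝ (fun y => u y 2) x (u x) -
      ∑ i : Fin 3, fderiv ℝ (fun y => fderiv ℝ (fun y' => u y' 2) y (EuclideanSpace.single i (1 : ℝ))) x
        (EuclideanSpace.single i (1 : ℝ)) = g (x 2))
    (hwave : ∀ x, fderiv ℝ (fun y => fderiv ℝ (fun y' => u y' 2) y (EuclideanSpace.single 2 (1 : ℝ))) x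
        (EuclideanSpace.single 2 (1 : ℝ)) =
      -μ * (fderiv ℝ (fun y => fderiv ℝ (fun y' => u y' 2) y (EuclideanSpace.single 0 (1 : ℝ))) x
          (EuclideanSpace.single 0 (1 : ℝ)) +
        fderiv ℝ (fun y => fderiv ℝ (fun y' => u y' 2) y (EuclideanSpace.single 1 (1 : ℝ))) x
          (EuclideanSpace.single 1 (1 : ℝ))))
    (hR : 0 < R) :
    (hmean φ c R z (fun x => 2 * u x 2 * θt x) - 2 * hmean φ c R z (fun x => u x 2) * hmean φ c R z θt) +
      2 * (hmean φ c R z (fun x => fderiv ℝ (fun y => u y 2 ^ 3) x (EuclideanSpace.single 2 (1 : ℝ))) / 2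
        - hmean φ c R z (fun x => fderiv ℝ u x (EuclideanSpace.single 2 (1 : ℝ)) 2) *
            hmean φ c R z (fun x => u x 2 ^ 2)
        - hmean φ c R z (fun x => u x 2) *
            hmean φ c R z (fun x => fderiv ℝ (fun y => u y 2 ^ 2) x (EuclideanSpace.single 2 (1 : ℝ)))
        + 3 / 2 * hmean φ c R z (fun x => u x 2) ^ 2 *
            hmean φ c R z (fun x => fderiv ℝ u x (EuclideanSpace.single 2 (1 : ℝ)) 2)) +
      2 * (1 - μ) * hmean φ c R z (fun x => fderiv ℝ (fun y => u y 2) x (EuclideanSpace.single 0 (1 : ℝ)) ^ 2 +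
          fderiv ℝ (fun y => u y 2) x (EuclideanSpace.single 1 (1 : ℝ)) ^ 2) ≤
      R⁻¹ * (8 * (M₀ * M₀ * M₀) + (4 + 2 * |1 - μ|) * (M₀ * M₁)) * bumpK φ := by
  have hθc : Continuous (fun y => u y 2) := (contDiff_coord hu 2).continuous
  have hM₀0 : 0 ≤ M₀ := (norm_nonneg _).trans (hM₀ 0)
  have hM₁0 : 0 ≤ M₁ := (norm_nonneg _).trans (hM₁ 0)
  have hK0 : 0 ≤ bumpK φ := bumpK_nonneg φ
  have hR0 : 0 ≤ R⁻¹ := inv_nonneg.2 hR.le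
  -- abbreviations
  set m := hmean φ c R z (fun x => u x 2) with hm
  set mt := hmean φ c R z θt with hmt
  set E := hmean φ c R z (fun x => u x 2 ^ 2) with hE
  set Ez := hmean φ c R z (fun x => fderiv ℝ (fun y => u y 2 ^ 2) x (EuclideanSpace.single 2 (1 : ℝ))) with hEz
  set mz := hmean φ c R z (fun x => fderiv ℝ u x (EuclideanSpace.single 2 (1 : ℝ)) 2) with hmz
  set mzz := hmean φ c R z (fun x => fderiv ℝ (fun y => fderiv ℝ u y (EuclideanSpace.single 2 (1 : ℝ)) 2) x
    (EuclideanSpace.single 2 (1 : ℝ))) with hmzz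
  set Tz := hmean φ c R z (fun x => fderiv ℝ (fun y => u y 2 ^ 3) x (EuclideanSpace.single 2 (1 : ℝ))) with hTz
  set Et := hmean φ c R z (fun x => 2 * u x 2 * θt x) with hEt
  set D := hmean φ c R z (fun x => fderiv ℝ (fun y => u y 2) x (EuclideanSpace.single 0 (1 : ℝ)) ^ 2 +
    fderiv ℝ (fun y => u y 2) x (EuclideanSpace.single 1 (1 : ℝ)) ^ 2) with hD
  -- the two identities and the four small means
  have hmzz' : mzz = hmean φ c R z (fun x => fderiv ℝ (fun y => fderiv ℝ (fun y' => u y' 2) y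
      (EuclideanSpace.single 2 (1 : ℝ))) x (EuclideanSpace.single 2 (1 : ℝ))) := by
    have hud : Differentiable ℝ u := hu.differentiable (by norm_num)
    have hfun : (fun y => fderiv ℝ u y (EuclideanSpace.single 2 (1 : ℝ)) 2) =
        fun y => fderiv ℝ (fun y' => u y' 2) y (EuclideanSpace.single 2 (1 : ℝ)) :=
      funext fun y => (fderiv_coord_apply (hud y) 2 _).symm
    rw [hmzz, hfun]
  have hb := residual_mean φ c z hu hdiv hM₀ hM₁ hθt heq hR
  rw [← hmt, ← hEz, ← hmzz'] at hb
  have hc' := energy_mean φ c z hu hdiv hM₀ hM₁ hθt heq hwave hR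
  rw [← hEt, ← hTz, ← hD, ← hm] at hc'
  have hz := abs_hmean_dz_le φ c z hu hdiv hM₀ hR
  rw [← hmz] at hz
  have hzz := abs_hmean_dzz_le φ c z hu hdiv hM₁ hR
  rw [← hmzz] at hzz
  have hmb : |m| ≤ M₀ := abs_hmean_le φ c R z hθc fun x => abs_coord_le hM₀ x 2
  have hEb : |E| ≤ M₀ * M₀ := abs_hmean_le φ c R z (F := fun x => u x 2 ^ 2) (hθc.pow 2) fun x => by
    rw [abs_pow, pow_two]; exact mul_le_mul (abs_coord_le hM₀ x 2) (abs_coord_le hM₀ x 2) (abs_nonneg _) hM₀0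
  -- algebra: LHS = ρc + 2mρb − 2m·mzz − 2mz·E + 3m²·mz
  set ρb := g (c 2 + z) - (mt + Ez - mzz) with hρb
  set ρc := Et + Tz + 2 * (1 - μ) * D - 2 * g (c 2 + z) * m with hρc
  have hid : (Et - 2 * m * mt) + 2 * (Tz / 2 - mz * E - m * Ez + 3 / 2 * m ^ 2 * mz) + 2 * (1 - μ) * D =
      ρc + 2 * m * ρb - 2 * m * mzz - 2 * mz * E + 3 * m ^ 2 * mz := by
    rw [hρb, hρc]; ring
  rw [hid]
  calc ρc + 2 * m * ρb - 2 * m * mzz - 2 * mz * E + 3 * m ^ 2 * mz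
      ≤ |ρc| + 2 * |m| * |ρb| + 2 * |m| * |mzz| + 2 * |mz| * |E| + 3 * |m| ^ 2 * |mz| := by
        have e1 : ρc ≤ |ρc| := le_abs_self _
        have e2 : 2 * m * ρb ≤ 2 * |m| * |ρb| := by
          rw [mul_assoc, mul_assoc, ← abs_mul]; exact mul_le_mul_of_nonneg_left (le_abs_self _) zero_le_two
        have e3 : -(2 * m * mzz) ≤ 2 * |m| * |mzz| := by
          rw [mul_assoc, mul_assoc, ← abs_mul, ← mul_neg]; exact mul_le_mul_of_nonneg_left (neg_le_abs _) zero_le_two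
        have e4 : -(2 * mz * E) ≤ 2 * |mz| * |E| := by
          rw [mul_assoc, mul_assoc, ← abs_mul, ← mul_neg]; exact mul_le_mul_of_nonneg_left (neg_le_abs _) zero_le_two
        have e5 : 3 * m ^ 2 * mz ≤ 3 * |m| ^ 2 * |mz| := by
          rw [← sq_abs m, mul_assoc, mul_assoc]
          exact mul_le_mul_of_nonneg_left (mul_le_mul_of_nonneg_left (le_abs_self _) (sq_nonneg _)) (by norm_num)
        linarith
    _ ≤ R⁻¹ * (M₀ * M₀ * M₀ + 2 * |1 - μ| * (M₀ * M₁)) * bumpK φ +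
          2 * M₀ * (R⁻¹ * (M₀ * M₀ + M₁) * bumpK φ) + 2 * M₀ * (R⁻¹ * M₁ * bumpK φ) +
          2 * (R⁻¹ * M₀ * bumpK φ) * (M₀ * M₀) + 3 * M₀ ^ 2 * (R⁻¹ * M₀ * bumpK φ) := by
        gcongr
    _ = R⁻¹ * (8 * (M₀ * M₀ * M₀) + (4 + 2 * |1 - μ|) * (M₀ * M₁)) * bumpK φ := by ring

end Slice

end Summit.NavierStokesRegularity.NavierStokesRegularity.Theorems.PoloidalWindowDoorPoloidalWindowRigidityConstantShearEnergy

end
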